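import Literature.Probability.Percolation.ArmSeparationFenceBound
import HarnessLib

/-!
# Kesten's separation step at a general density `p`: fences fail with probability `(1 - c_F²)^K`

Topic: Probability / Percolation; family `crit-perc` / near-critical percolation on the triangular
lattice `𝕋` (`P_p = triSitePercolation p`, ANY `p : unitInterval`). `ArmSeparationFenceBound.lean`
proves the estimates of Nolin 2008, §4.4, proof of Lemma 15 [arXiv 0711.4948: Lemma 14,
(4.16)–(4.20)] — the probabilistic layer of Kesten's arm-separation step behind side `0` of
`∂Λ_{2M}` — at the self-dual point `p = 1/2` only (`P = triSitePercolation half`, RSW input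
`tri_rsw_half_holds`, colour exchange `σ(1/2) = 1/2`). Nolin states and proves his separation
theorem (Thm. 11 [arXiv Thm. 10]) "uniformly in `p`, `P̂` between `P_p` and `P_{1-p}`,
`n ≤ N ≤ L(p)`": the proof uses nothing about the measure beyond independence, the Harris–FKG and
BK inequalities, and Russo–Seymour–Welsh lower bounds for BOTH colours at the scales at hand
(which hold below the characteristic length `L(p)`, Nolin §3.1 (3.5)–(3.6); in the tree
`exists_pow_le_triLRCrossingProb_below`, `OneArmQuasiMultNearCritical.lean`). This file is the
verbatim re-run of `ArmSeparationFenceBound.lean` at a general density `p`, with the two RSW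
inputs made explicit hypotheses AT THE SCALES USED:

* frames: `hF : ∀ z k, 1 ≤ k → k < S → c_F ≤ P_p(triFrameAt z k)` (open frames of the colour being
  separated, up to the scale `S`; at `p` they come from RSW at aspect ratio `4` and height `k`,
  `le_real_triFrameAt_of_rsw`);
* the blocking crossing: `hc₄ : c₄ ≤ triLRCrossingProb (σ p) (4 (M - 1)) (M - 1)` — an open crossing
  at the DUAL density `1 - p`, i.e. a closed vertical crossing of the bounding parallelogram of the
  trapezoid at `p` (`sitePercolation_real_preimage_compl`: `P_p(ωᶜ ∈ V) = P_{1-p}(V)`).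

All deterministic objects (`triFrameAt`, `trapRSW`, `trapScale`, `TrapFenceOK`, `TrapSeqFail`,
`TrapNoRSW`, `trapCrossEvent`, the exploration sequence `lowestSeq` of `trapDomain M`) are those of
`ArmSeparationFenceBound.lean` / `ArmSeparationFrame.lean` / `TriLowestCrossing.lean`, imported,
not redefined. Results (same names, suffix `_at` / `_of_rsw`):

* `le_real_triFrameAt_of_rsw` — `c ≤ P_p(LR(4k, k))` gives `c⁴ ≤ P_p(triFrameAt z k)` (Harris);
* `sq_le_real_trapRSW_at` — `c_F² ≤ P_p(trapRSW z k)` from frames at the scales `k` and `8k`;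
* `real_iInter_compl_trapRSW_le_at` — independent scales: `P_p(⋂_{j<K} (trapRSW z k_j)ᶜ) ≤ (1 - c_F²)^K`;
* `real_trapSeqFail_le_at` — the union bound over the values of the `u`-th lowest crossing;
* `real_trapCrossEvent_le_at` — `P_p(trapCrossEvent M) ≤ 1 - c₄`;
* `real_lowestSeq_ne_none_le_at` — BK: `P_p(lowestSeq u ≠ none) ≤ (1 - c₄)^{u+1}`;
* `real_trapSeparation_fail_le_at` — the per-side estimate
  `P_p(lowestSeq T ≠ none) + Σ_{u<T} P_p(TrapSeqFail u) ≤ (1 - c₄)^{T+1} + T (1 - c_F²)^K`.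

At `p = 1/2` these specialise to the statements of `ArmSeparationFenceBound.lean` (with
`exists_pos_le_real_triFrameAt` and `tri_rsw_half_holds 4`). They are the first brick of the
near-critical (uniform below `L(p)`) arm-separation theorem for `j = 4`, the hypothesis of
`Werner2009_fourArm_quasiMult_of_separation` (`NearCriticalFourArmQuasiMult.lean`) and of
`Nolin2008_cor41_of_separation` (`NearCriticalScalingFromSeparation.lean`). Everything here is
proved; no named facts are introduced.

## References

* P. Nolin, *Near-critical percolation in two dimensions*, Electron. J. Probab. 13 (2008), Thm. 11
  and §4.4, proof of Lemma 15 [arXiv 0711.4948: Thm. 10, Lemma 14, (4.16)–(4.20)], "uniformly in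
  `p`, `P̂` between `P_p` and `P_{1-p}`, `n ≤ N ≤ L(p)`". [Nolin2008]
* H. Kesten, *Scaling relations for 2D-percolation*, Comm. Math. Phys. 109 (1987), Lemma 2 and
  Lemma 4 (uniformity in `p ≥ p_c`... below `L(p)`). [Kesten1987]
* W. Werner, *Lectures on two-dimensional critical percolation*, PCMI (2009), Lecture 6, Prop. 6.1
  (separation "for all `p` and `n ≤ L(p)`"). [WernerPCMI2009]

Tree: everything of `ArmSeparationFenceBound.lean` (deterministic part reused, probabilistic part
re-run); `sitePercolation_harris`, `sitePercolation_real_inter_of_disjoint`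
(`SitePercolationMeasure.lean`); `real_disjointOccurrencePow_le_pow` (`TriAnnulusArms.lean`);
`triSitePercolation_real_triHCross/VCross`, `triLRCrossingProb_anti_width` (`TriRSWChaining.lean`);
`sitePercolation_real_preimage_compl` (`TriHexLemma.lean`). Mathlib: `measureReal_biUnion_finset(_le)`,
`measureReal_compl`.
-/

noncomputable section

open MeasureTheory Set
open scoped unitInterval

namespace Literature.Probability.Percolation

open LatticeModels

/-! ### RSW for frames at density `p` -/

/-- **Frames from RSW at density `p`**: if the `4k × k` parallelogram is crossed the long way at
`p` with probability at least `c ≥ 0`, then `P_p(triFrameAt z k) ≥ c⁴` (the four long-way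
crossings of the frame, multiplied by Harris' inequality; Grimmett 1999, (11.72); Nolin 2008,
§4.4, the constant `δ''`, "by RSW", uniformly in `p` below `L(p)`). [cite: Nolin2008, §4.4 Lemma 15 (proof) (arXiv 0711.4948: Lemma 14), with Thm. 11 "uniformly in p"] -/
theorem le_real_triFrameAt_of_rsw (p : unitInterval) {c : ℝ} (hc0 : 0 ≤ c) (z : Site 2) (k : ℕ)
    (hck : c ≤ triLRCrossingProb p (4 * k) k) :
    c ^ 4 ≤ (triSitePercolation p).real (triFrameAt z k) := by
  set F := triSqAnnulusFinset z k (2 * k)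
  have sub : ∀ (a b : ℤ) (m n : ℕ), (∀ v : Site 2, v ∈ triStrip a b m n → v ∈ F) →
      (↑(triStripFinset a b m n) : Set (Site 2)) ⊆ ↑F := by
    intro a b m n h v hv
    rw [coe_triStripFinset] at hv
    exact Finset.mem_coe.2 (h v hv)
  have d1 : DeterminedBy (triHCross (z 0 - 2 * k) (z 1 + k) (4 * k) k) ↑F :=
    (determinedBy_triHCross _ _ _ _).mono (sub _ _ _ _ fun v hv => by
      rw [mem_triStrip] at hv; rw [mem_triSqAnnulusFinset]; push_cast at hv ⊢; omega)
  have d2 : DeterminedBy (triHCross (z 0 - 2 * k) (z 1 - 2 * k) (4 * k) k) ↑F :=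
    (determinedBy_triHCross _ _ _ _).mono (sub _ _ _ _ fun v hv => by
      rw [mem_triStrip] at hv; rw [mem_triSqAnnulusFinset]; push_cast at hv ⊢; omega)
  have d3 : DeterminedBy (triVCross (z 0 - 2 * k) (z 1 - 2 * k) k (4 * k)) ↑F :=
    (determinedBy_triVCross _ _ _ _).mono (sub _ _ _ _ fun v hv => by
      rw [mem_triStrip] at hv; rw [mem_triSqAnnulusFinset]; push_cast at hv ⊢; omega)
  have d4 : DeterminedBy (triVCross (z 0 + k) (z 1 - 2 * k) k (4 * k)) ↑F :=
    (determinedBy_triVCross _ _ _ _).mono (sub _ _ _ _ fun v hv => by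
      rw [mem_triStrip] at hv; rw [mem_triSqAnnulusFinset]; push_cast at hv ⊢; omega)
  have u1 := isUpperSet_triHCross (z 0 - 2 * k) (z 1 + k) (4 * k) k
  have u2 := isUpperSet_triHCross (z 0 - 2 * k) (z 1 - 2 * k) (4 * k) k
  have u3 := isUpperSet_triVCross (z 0 - 2 * k) (z 1 - 2 * k) k (4 * k)
  have u4 := isUpperSet_triVCross (z 0 + k) (z 1 - 2 * k) k (4 * k)
  have e1 := triSitePercolation_real_triHCross p (z 0 - 2 * k) (z 1 + k) (4 * k) k
  have e2 := triSitePercolation_real_triHCross p (z 0 - 2 * k) (z 1 - 2 * k) (4 * k) k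
  have e3 := triSitePercolation_real_triVCross p (z 0 - 2 * k) (z 1 - 2 * k) k (4 * k)
  have e4 := triSitePercolation_real_triVCross p (z 0 + k) (z 1 - 2 * k) k (4 * k)
  have hH := sitePercolation_harris p d1 d2 u1 u2
  have hV := sitePercolation_harris p d3 d4 u3 u4
  have hHV := sitePercolation_harris p (d1.inter d2) (d3.inter d4) (u1.inter u2) (u3.inter u4)
  unfold triSitePercolation at e1 e2 e3 e4 ⊢
  rw [e1, e2] at hH
  rw [e3, e4] at hV
  have h0 : 0 ≤ triLRCrossingProb p (4 * k) k := measureReal_nonneg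
  calc c ^ 4 ≤ triLRCrossingProb p (4 * k) k ^ 4 := by gcongr
    _ = (triLRCrossingProb p (4 * k) k * triLRCrossingProb p (4 * k) k) *
          (triLRCrossingProb p (4 * k) k * triLRCrossingProb p (4 * k) k) := by ring
    _ ≤ _ := (mul_le_mul hH hV (mul_nonneg h0 h0) measureReal_nonneg).trans hHV

/-- `P_p(trapRSW z k) ≥ c_F²` from frames of probability `≥ c_F` at the scales `k` and `8k`
(Harris), at any density `p`. [cite: Nolin2008, §4.4 Lemma 15 (proof) (arXiv 0711.4948: Lemma 14), with Thm. 11 "uniformly in p"] -/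
theorem sq_le_real_trapRSW_at (p : unitInterval) {cF : ℝ} (hcF : 0 < cF) (z : Site 2) (k : ℕ)
    (h1 : cF ≤ (triSitePercolation p).real (triFrameAt z k))
    (h8 : cF ≤ (triSitePercolation p).real (triFrameAt z (8 * k))) :
    cF ^ 2 ≤ (triSitePercolation p).real (trapRSW z k) := by
  have d1 := (determinedBy_triFrameAt z k).mono (show (↑(triSqAnnulusFinset z k (2 * k)) : Set (Site 2)) ⊆
    ↑(triSqAnnulusFinset z k (16 * k)) from fun v hv => by
      rw [Finset.mem_coe, mem_triSqAnnulusFinset] at hv ⊢; push_cast at hv ⊢; omega)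
  have d2 := (determinedBy_triFrameAt z (8 * k)).mono (show (↑(triSqAnnulusFinset z (8 * k) (2 * (8 * k))) : Set (Site 2)) ⊆
    ↑(triSqAnnulusFinset z k (16 * k)) from fun v hv => by
      rw [Finset.mem_coe, mem_triSqAnnulusFinset] at hv ⊢; push_cast at hv ⊢; omega)
  have h := sitePercolation_harris p d1 d2 (isUpperSet_triFrameAt z k) (isUpperSet_triFrameAt z (8 * k))
  unfold triSitePercolation at h1 h8 ⊢
  calc cF ^ 2 = cF * cF := sq cF
    _ ≤ _ := (mul_le_mul h1 h8 hcF.le measureReal_nonneg).trans h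

/-! ### Independent scales -/

/-- **Independent scales at density `p`**: if all frames of scales `k < S` about `z` have
probability `≥ c_F`, then along the scales `k_j = k₀ · 32^j`, `j < K`, with `8 k_j < S`,
`P_p(⋂_{j<K} (trapRSW z k_j)ᶜ) ≤ (1 - c_F²)^K`, and this event is determined by the union of the
square annuli of the scales (Nolin 2008, §4.4: "with probability at least
`1 - (1 - δ'')^{-C₄ log η}` there exists a circuit in one of the annuli", at every `p`, below `L(p)`). [cite: Nolin2008, §4.4 Lemma 15 (proof) (arXiv 0711.4948: Lemma 14), with Thm. 11 "uniformly in p"] -/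
theorem real_iInter_compl_trapRSW_le_at (p : unitInterval) {cF : ℝ} (hcF : 0 < cF) {S : ℕ}
    (hF : ∀ (z : Site 2) (k : ℕ), 1 ≤ k → k < S → cF ≤ (triSitePercolation p).real (triFrameAt z k))
    (z : Site 2) {k₀ : ℕ} (hk₀ : 1 ≤ k₀) :
    ∀ K : ℕ, (∀ j < K, 8 * trapScale k₀ j < S) →
      (triSitePercolation p).real (⋂ j ∈ Finset.range K, (trapRSW z (trapScale k₀ j))ᶜ) ≤ (1 - cF ^ 2) ^ K ∧
        DeterminedBy (⋂ j ∈ Finset.range K, (trapRSW z (trapScale k₀ j))ᶜ) ↑(trapScalesFinset z k₀ K)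
  | 0 => fun _ => by
    constructor
    · simp
    · simp only [Finset.range_zero, Finset.notMem_empty, Set.iInter_of_empty, Set.iInter_univ]
      exact determinedBy_univ _
  | K + 1 => fun hKS => by
    obtain ⟨ihle, ihdet⟩ := real_iInter_compl_trapRSW_le_at p hcF hF z hk₀ K
      (fun j hj => hKS j (Nat.lt_succ_of_lt hj))
    have hsplit : (⋂ j ∈ Finset.range (K + 1), (trapRSW z (trapScale k₀ j))ᶜ) =
        (⋂ j ∈ Finset.range K, (trapRSW z (trapScale k₀ j))ᶜ) ∩ (trapRSW z (trapScale k₀ K))ᶜ := by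
      rw [Finset.range_add_one, Finset.set_biInter_insert, Set.inter_comm]
    have hdetK : DeterminedBy (trapRSW z (trapScale k₀ K))ᶜ ↑(triSqAnnulusFinset z (trapScale k₀ K) (16 * trapScale k₀ K)) :=
      (determinedBy_trapRSW z (trapScale k₀ K)).compl
    have hK8 : 8 * trapScale k₀ K < S := hKS K (Nat.lt_succ_self K)
    have hK1 : 1 ≤ trapScale k₀ K := one_le_trapScale hk₀ K
    constructor
    · rw [hsplit]
      unfold triSitePercolation at ihle hF ⊢
      rw [sitePercolation_real_inter_of_disjoint p ihdet hdetK (disjoint_trapScalesFinset hk₀ z K)]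
      have hc : (sitePercolation (Site 2) p).real (trapRSW z (trapScale k₀ K))ᶜ ≤ 1 - cF ^ 2 := by
        rw [measureReal_compl (measurableSet_trapRSW _ _), probReal_univ]
        have := sq_le_real_trapRSW_at p hcF z (trapScale k₀ K) (hF z _ hK1 (by omega))
          (hF z _ (by omega) (by omega))
        unfold triSitePercolation at this
        linarith
      have h1 : 0 ≤ 1 - cF ^ 2 := le_trans measureReal_nonneg hc
      rw [pow_succ]
      exact mul_le_mul ihle hc measureReal_nonneg (pow_nonneg h1 K)
    · rw [hsplit]
      refine (ihdet.mono ?_).inter (hdetK.mono ?_)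
      · intro v hv
        rw [Finset.mem_coe, trapScalesFinset, Finset.mem_biUnion] at hv ⊢
        obtain ⟨j, hj, hv⟩ := hv
        exact ⟨j, Finset.mem_range.2 (Nat.lt_succ_of_lt (Finset.mem_range.1 hj)), hv⟩
      · intro v hv
        rw [Finset.mem_coe, trapScalesFinset, Finset.mem_biUnion]
        exact ⟨K, Finset.self_mem_range_succ K, hv⟩

/-! ### The union bound over the values of a lowest crossing -/

/-- **The union bound over the values of the `u`-th lowest crossing, at density `p`** (Nolin 2008,
(4.19): "summing over all possibilities for `c̃_i`, `σ̃_i` (`1 ≤ i ≤ u`), we get that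
`P(t ≥ u and c_u is not protected from above) ≤ (1 - δ'')^{-C log η}`", at every `p` below `L(p)`):
if all open frames of scales `k < M` have `P_p ≥ c_F`, then
`P_p(TrapSeqFail M u k₀ K) ≤ P_p(lowestSeq u ≠ none) · (1 - c_F²)^K` (`16 k_j + 1 ≤ M` for `j < K`).
Proof verbatim that of `real_trapSeqFail_le`: `{lowestSeq u = (c, z)}` is determined by
`lower c z` (`JDomain.determinedBy_lowestSeq_eq`), the failure forces `TrapNoRSW` (determined by the
annuli off `lower c z`), the product formula for disjoint supports (valid for every product
measure `P_p`) and `real_iInter_compl_trapRSW_le_at` bound each term, and finite additivity sums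
over the values. [cite: Nolin2008, §4.4 Lemma 15 (proof) (arXiv 0711.4948: Lemma 14, (4.19)), with Thm. 11 "uniformly in p"] -/
theorem real_trapSeqFail_le_at (p : unitInterval) {cF : ℝ} (hcF : 0 < cF) (hcF1 : cF ≤ 1) {M : ℕ}
    (hF : ∀ (z : Site 2) (k : ℕ), 1 ≤ k → k < M → cF ≤ (triSitePercolation p).real (triFrameAt z k))
    {u k₀ K : ℕ} (hM : 1 ≤ M) (hk₀ : 1 ≤ k₀) (hKM : ∀ j < K, 16 * (trapScale k₀ j : ℤ) + 1 ≤ M) :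
    (triSitePercolation p).real {ω | TrapSeqFail M u k₀ K ω} ≤
      (triSitePercolation p).real {ω | (trapDomain M).lowestSeq ω u ≠ none} * (1 - cF ^ 2) ^ K := by
  classical
  have hcut := trapDomain_cutProp M
  have hdual := trapDomain_dualProp hM
  have hKS : ∀ j < K, 8 * trapScale k₀ j < M := fun j hj => by have := hKM j hj; omega
  set μ := triSitePercolation p with hμ
  set E : Finset (Site 2) × Site 2 → Set (SiteConfig (Site 2)) :=
    fun q => {ω | (trapDomain M).lowestSeq ω u = some q} with hE
  -- decomposition of the failure event over the values
  have hsub : {ω | TrapSeqFail M u k₀ K ω} ⊆ ⋃ q ∈ trapPairs M, (E q ∩ {ω | TrapNoRSW M q.1 q.2 k₀ K ω}) := by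
    rintro ω ⟨c, z, h, hfail⟩
    simp only [Set.mem_iUnion, Set.mem_inter_iff, Set.mem_setOf_eq]
    exact ⟨(c, z), mem_trapPairs_of_lowestSeq h, h, trapNoRSW_of_fail hk₀ hKM h hfail⟩
  -- each term
  have hterm : ∀ q ∈ trapPairs M, μ.real (E q ∩ {ω | TrapNoRSW M q.1 q.2 k₀ K ω}) ≤ μ.real (E q) * (1 - cF ^ 2) ^ K := by
    rintro ⟨c, z⟩ -
    have hEdet : DeterminedBy (E (c, z)) ↑((trapDomain M).lower c z) :=
      JDomain.determinedBy_lowestSeq_eq hcut hdual u c z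
    have hNdet := determinedBy_trapNoRSW M c z k₀ K
    have hdisj : Disjoint ((trapDomain M).lower c z) (trapScalesFinset z k₀ K \ (trapDomain M).lower c z) :=
      Finset.disjoint_sdiff
    rw [hμ]
    unfold triSitePercolation
    rw [sitePercolation_real_inter_of_disjoint p hEdet hNdet hdisj]
    refine mul_le_mul_of_nonneg_left ?_ measureReal_nonneg
    have h1 := (real_iInter_compl_trapRSW_le_at p hcF hF z hk₀ K hKS).1
    unfold triSitePercolation at h1
    exact (measureReal_mono (trapNoRSW_subset M c z k₀ K)).trans h1
  -- finite additivity over the values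
  have hmeas : ∀ q ∈ trapPairs M, MeasurableSet (E q) := fun q _ =>
    (JDomain.determinedBy_lowestSeq_eq hcut hdual u q.1 q.2).measurableSet_of_finset
  have hdisjE : (↑(trapPairs M) : Set (Finset (Site 2) × Site 2)).PairwiseDisjoint E := fun q _ q' _ hqq' =>
    JDomain.disjoint_setOf_lowestSeq_eq hqq'
  have hunion : μ.real (⋃ q ∈ trapPairs M, E q) ≤ μ.real {ω | (trapDomain M).lowestSeq ω u ≠ none} := by
    refine measureReal_mono ?_
    intro ω hω
    simp only [Set.mem_iUnion, Set.mem_setOf_eq] at hω ⊢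
    obtain ⟨q, -, hq⟩ := hω
    rw [hq]; exact Option.some_ne_none q
  have h0 : 0 ≤ 1 - cF ^ 2 := by nlinarith
  calc μ.real {ω | TrapSeqFail M u k₀ K ω}
      ≤ μ.real (⋃ q ∈ trapPairs M, (E q ∩ {ω | TrapNoRSW M q.1 q.2 k₀ K ω})) :=
        measureReal_mono hsub (measure_ne_top _ _)
    _ ≤ ∑ q ∈ trapPairs M, μ.real (E q ∩ {ω | TrapNoRSW M q.1 q.2 k₀ K ω}) := measureReal_biUnion_finset_le _ _
    _ ≤ ∑ q ∈ trapPairs M, μ.real (E q) * (1 - cF ^ 2) ^ K := Finset.sum_le_sum hterm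
    _ = (∑ q ∈ trapPairs M, μ.real (E q)) * (1 - cF ^ 2) ^ K := (Finset.sum_mul _ _ _).symm
    _ = μ.real (⋃ q ∈ trapPairs M, E q) * (1 - cF ^ 2) ^ K := by rw [measureReal_biUnion_finset hdisjE hmeas]
    _ ≤ μ.real {ω | (trapDomain M).lowestSeq ω u ≠ none} * (1 - cF ^ 2) ^ K :=
        mul_le_mul_of_nonneg_right hunion (pow_nonneg h0 K)

/-! ### The number of disjoint crossings: `P_p(lowestSeq u ≠ none) ≤ (1 - δ')^{u+1}` -/

/-- **The crossing event is not certain, at density `p`**: `P_p(trapCrossEvent M) ≤ 1 - c₄` for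
`M ≥ 3`, where `c₄ ≤ P_{1-p}(LR(4(M-1), M-1))` bounds below the long-way crossing probability at
the DUAL density — a CLOSED vertical crossing of the bounding parallelogram
`[M+1, 2M] × [-2M, M-1]` at `p` (law `P_{1-p}` of open crossings, `sitePercolation_real_preimage_compl`)
runs in `T` from `trapB` until it leaves `T` through `trapU`, and such a closed `trapB–trapU` path is
incompatible with an open `trapI–trapO` crossing (`JDomain.CutProp` of `trapDomain`). (Nolin 2008,
(4.16): "the probability of crossing this domain is less than some `1 - δ'` (by RSW)", uniformly in
`p` below `L(p)`.) [cite: Nolin2008, §4.4 Lemma 15 (proof) (arXiv 0711.4948: (4.16)), with Thm. 11 "uniformly in p"] -/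
theorem real_trapCrossEvent_le_at (p : unitInterval) {c₄ : ℝ} {M : ℕ} (hM : 3 ≤ M)
    (hc₄ : c₄ ≤ triLRCrossingProb (σ p) (4 * (M - 1)) (M - 1)) :
    (triSitePercolation p).real (trapCrossEvent M) ≤ 1 - c₄ := by
  classical
  -- the closed vertical crossing of the bounding parallelogram
  set V : Set (SiteConfig (Site 2)) := triVCross ((M : ℤ) + 1) (-(2 * (M : ℤ))) (M - 1) (3 * M - 1) with hV
  have hm : ((M - 1 : ℕ) : ℤ) = (M : ℤ) - 1 := by omega
  have hn : ((3 * M - 1 : ℕ) : ℤ) = 3 * (M : ℤ) - 1 := by omega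
  -- (i) a configuration whose complement crosses vertically has no open `trapI–trapO` crossing
  have hdisj : ∀ ω : SiteConfig (Site 2), ωᶜ ∈ V → ω ∉ trapCrossEvent M := by
    intro ω hωV hω
    obtain ⟨x, y, hx, hy, hxy⟩ := hωV
    obtain ⟨a, ha, z, hz, haz⟩ := hω
    -- the open crossing contains a crossing of `trapDomain`
    obtain ⟨S, hS, hSp, -⟩ := haz.exists_support
    set S' : Finset (Site 2) := (trapD M).filter fun v => v ∈ S with hS'
    have hcoe : (↑S' : Set (Site 2)) = S := by
      ext v
      simp only [hS', Finset.coe_filter, Set.mem_setOf_eq]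
      exact ⟨fun h => h.2, fun h => ⟨Finset.mem_coe.1 (hS h).1, h⟩⟩
    obtain ⟨c, w, hc, hcS⟩ := (trapDomain M).exists_crossing_subset (Finset.filter_subset _ _) ha hz (hcoe ▸ hSp)
    have hcω : ∀ v ∈ c, v ∈ ω := fun v hv => (hS (hcoe ▸ Finset.mem_coe.2 (hcS hv))).2
    -- the closed vertical crossing runs in `T ∖ c` from `trapB` until it leaves through `trapU`
    have hxD : x ∈ trapD M := by
      have h1 := hxy.left_mem.1
      rw [mem_triStrip] at h1
      rw [mem_trapD]; omega
    have hxB : x ∈ trapB M := mem_trapB.2 ⟨hxD, hx⟩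
    have hTS : ∀ v : Site 2, v ∈ trapD M → v ∈ triStrip ((M : ℤ) + 1) (-(2 * (M : ℤ))) (M - 1) (3 * M - 1) ∩ ωᶜ →
        v ∈ (↑((trapDomain M).D \ c) : Set (Site 2)) := by
      intro v hvD hv
      rw [trapDomain_D, Finset.coe_sdiff]
      exact ⟨Finset.mem_coe.2 hvD, fun hvc => hv.2 (hcω v hvc)⟩
    obtain ⟨e, he, hpath⟩ : ∃ e ∈ trapU M, PathIn triGraph (↑((trapDomain M).D \ c) : Set (Site 2)) x e := by
      rcases hxy.exit_or (R := (↑(trapD M) : Set (Site 2))) (Finset.mem_coe.2 hxD) with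
        h | ⟨p', q, hpD, hqD, hqR, hpq, hxp⟩
      · have hyD : y ∈ trapD M := Finset.mem_coe.1 h.right_mem.1
        have hyD' := mem_trapD.1 hyD
        have hy1 := h.right_mem.2.1
        rw [mem_triStrip] at hy1
        refine ⟨y, mem_trapU.2 ⟨hyD, by omega⟩, h.mono fun v hv => hTS v (Finset.mem_coe.1 hv.1) hv.2⟩
      · have hpD' : p' ∈ trapD M := Finset.mem_coe.1 hpD
        refine ⟨p', mem_trapU.2 ⟨hpD', ?_⟩, hxp.mono fun v hv => hTS v (Finset.mem_coe.1 hv.1) hv.2⟩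
        have h1 := hqR.1
        rw [mem_triStrip] at h1
        have hpT := mem_trapD.1 hpD'
        have hqT : ¬ (q ∈ trapD M) := fun h' => hqD (Finset.mem_coe.2 h')
        rw [mem_trapD] at hqT
        have h2 := add_le_add_add_one_of_adj hpq
        omega
    exact trapDomain_cutProp M hc x (Finset.mem_union_left _ hxB) e (Finset.mem_union_left _ he) hpath
  -- (ii) hence `P_p(cross) + P_p(compl ∈ V) ≤ 1`, and `P_p(compl ∈ V) = P_{1-p}(V) ≥ c₄`
  have hVdet : DeterminedBy V ↑(triStripFinset ((M : ℤ) + 1) (-(2 * (M : ℤ))) (M - 1) (3 * M - 1)) :=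
    determinedBy_triVCross _ _ _ _
  have hVmeas : MeasurableSet (compl ⁻¹' V) :=
    (determinedBy_compl_mem hVdet).measurableSet_of_finset
  have hsub : trapCrossEvent M ⊆ (compl ⁻¹' V)ᶜ := fun ω hω hωV => hdisj ω hωV hω
  have hVprob : c₄ ≤ (triSitePercolation p).real (compl ⁻¹' V) := by
    unfold triSitePercolation
    rw [sitePercolation_real_preimage_compl]
    have e := triSitePercolation_real_triVCross (σ p) ((M : ℤ) + 1) (-(2 * (M : ℤ))) (M - 1) (3 * M - 1)
    unfold triSitePercolation at e
    rw [e]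
    exact hc₄.trans (triLRCrossingProb_anti_width (σ p) (by omega) (M - 1))
  calc (triSitePercolation p).real (trapCrossEvent M)
      ≤ (triSitePercolation p).real (compl ⁻¹' V)ᶜ := measureReal_mono hsub
    _ = 1 - (triSitePercolation p).real (compl ⁻¹' V) := by rw [measureReal_compl hVmeas, probReal_univ]
    _ ≤ 1 - c₄ := by linarith

/-- **`P_p(lowestSeq u ≠ none) ≤ (1 - δ')^{u+1}`** at density `p` (Nolin 2008, (4.17): "combined
with the BK inequality, this implies that the probability of observing at least `h` crossings is
less than `(1 - δ')^h`", uniformly in `p` below `L(p)`): `u + 1` terms of the exploration sequence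
are `u + 1` disjoint occurrences of the crossing event, and the iterated BK inequality (valid for
every product measure `P_p`) applies. [cite: Nolin2008, §4.4 Lemma 15 (proof) (arXiv 0711.4948: (4.17)), with Thm. 11 "uniformly in p"] -/
theorem real_lowestSeq_ne_none_le_at (p : unitInterval) {c₄ : ℝ} {M : ℕ} (hM : 3 ≤ M)
    (hc₄ : c₄ ≤ triLRCrossingProb (σ p) (4 * (M - 1)) (M - 1)) (u : ℕ) :
    (triSitePercolation p).real {ω | (trapDomain M).lowestSeq ω u ≠ none} ≤ (1 - c₄) ^ (u + 1) := by
  have h1 : (triSitePercolation p).real {ω | (trapDomain M).lowestSeq ω u ≠ none} ≤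
      (triSitePercolation p).real (disjointOccurrencePow (trapCrossEvent M) (u + 1)) :=
    measureReal_mono fun ω hω => mem_disjointOccurrencePow_of_lowestSeq_ne_none hω
  have h2 := real_disjointOccurrencePow_le_pow p (determinedBy_trapCrossEvent M) (isUpperSet_trapCrossEvent M) (u + 1)
  have h3 := real_trapCrossEvent_le_at p hM hc₄
  unfold triSitePercolation at h1 h3 ⊢
  refine h1.trans (h2.trans ?_)
  exact pow_le_pow_left₀ measureReal_nonneg h3 _

/-- **Kesten's separation step for the open colour behind side `0` at density `p`, the per-scale
estimate** (Nolin 2008, proof of Lemma 15, (4.17)–(4.20): `P(t ≥ T) ≤ (1-δ')^T` and, for each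
`u < T`, `P(t ≥ u and c_u is not protected from above) ≤ (1-δ'')^{-C log η}`, "for any `p`, any
`P̂` between `P_p` and `P_{1-p}` and any `N ≤ L(p)`"): for `M ≥ 3` with `16 k_{K-1} + 1 ≤ M`, open
frames of scales `< M` of probability `≥ c_F ∈ (0, 1]` at `p`, and `c₄ ≤ P_{1-p}(LR(4(M-1), M-1))`,
`P_p(lowestSeq T ≠ none) + Σ_{u<T} P_p(TrapSeqFail M u k₀ K) ≤ (1 - c₄)^{T+1} + T (1 - c_F²)^K`. [cite: Nolin2008, §4.4 Lemma 15 (proof) (arXiv 0711.4948: Lemma 14, (4.20)), with Thm. 11 "uniformly in p"] -/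
theorem real_trapSeparation_fail_le_at (p : unitInterval) {cF c₄ : ℝ} (hcF : 0 < cF) (hcF1 : cF ≤ 1) {M : ℕ}
    (hF : ∀ (z : Site 2) (k : ℕ), 1 ≤ k → k < M → cF ≤ (triSitePercolation p).real (triFrameAt z k))
    (hM : 3 ≤ M) (hc₄ : c₄ ≤ triLRCrossingProb (σ p) (4 * (M - 1)) (M - 1))
    {T k₀ K : ℕ} (hk₀ : 1 ≤ k₀) (hKM : ∀ j < K, 16 * (trapScale k₀ j : ℤ) + 1 ≤ M) :
    (triSitePercolation p).real {ω | (trapDomain M).lowestSeq ω T ≠ none} +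
        ∑ u ∈ Finset.range T, (triSitePercolation p).real {ω | TrapSeqFail M u k₀ K ω} ≤
      (1 - c₄) ^ (T + 1) + T * (1 - cF ^ 2) ^ K := by
  have hT := real_lowestSeq_ne_none_le_at p hM hc₄ T
  have hsum : ∑ u ∈ Finset.range T, (triSitePercolation p).real {ω | TrapSeqFail M u k₀ K ω} ≤
      ∑ u ∈ Finset.range T, (1 : ℝ) * (1 - cF ^ 2) ^ K := by
    refine Finset.sum_le_sum fun u _ => ?_
    refine (real_trapSeqFail_le_at p hcF hcF1 hF (by omega) hk₀ hKM).trans ?_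
    have h0 : 0 ≤ 1 - cF ^ 2 := by nlinarith
    exact mul_le_mul_of_nonneg_right measureReal_le_one (pow_nonneg h0 K)
  rw [Finset.sum_const, Finset.card_range, nsmul_eq_mul] at hsum
  linarith

end Literature.Probability.Percolation
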